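import Summits.CriticalPhenomena.PercolationContinuityZ3.Theorems.PercNearOneGluingNoHeavyLowerTailKNGoodTwoTwoStars
import Summits.CriticalPhenomena.PercolationContinuityZ3.Theorems.PercNearOneGluingNoHeavyLowerTailKNGoodConjOne
import HarnessLib

/-!
# Kozma–Nitzan's Conjecture 1 (weak max-form) for an observer with two pendant two-port star children over an arbitrary core
# (`NoHeavyLowerTail` cell, stmt-CriticalPhenomena-4575; prover `prim-hp-2`, deletion–contraction line, gen 8)

Support file (`--supports stmt-CriticalPhenomena-4575`).  No definitions, no named facts, no sorries.

Corollary of `KNGoodTwoTwo.knGood_twoPendantTwoPortStars` through the bridge `KNGoodConjOne.conj1_weak_of_knGood` ("a good quadruple satisfies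
the pre-FKG inequality (2)", Kozma–Nitzan p. 12, plus Harris): for the observer class of that theorem — `o ∉ A` with relay hairs and two pendant
stars `x – {p₁,p₂}`, `y – {q₁,q₂}` on disjoint relay ports with hairs in `(0,1)`, ARBITRARY core — and every `M` with `μ(a ↮ b) ≤ M` for all `a ∈ A`:
`μ(o ↔ A) − μ(o ↔ b) ≤ μ(o ↔ A)·M`, i.e. `μ(o ↔ b) ≥ μ(o ↔ A)·(1 − max_a μ(a ↮ b))` (Kozma–Nitzan's inequality (3) / Conjecture 1 in max-form).
-/

namespace Summit.CriticalPhenomena.PercolationContinuityZ3.Theorems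

open MeasureTheory Set ProbabilityTheory Literature.Probability.LatticeModels Literature.Probability.Percolation

noncomputable section
open Classical

namespace KNGoodTwoTwo
open KNGoodConjOne

variable {n : ℕ}

/-- **Conjecture 1 (weak max-form) for `o` + relay hairs + two pendant two-port stars on disjoint ports, any core.**  See the module docstring.
[cite: KozmaNitzan2024, Conjecture 1 and (3) (p. 3), §3.2 (p. 12), Thm. 4–5 (pp. 12–14)] -/
theorem conj1_weak_twoPendantTwoPortStars (w : Sym2 (Fin n) → unitInterval) (A : Finset (Fin n)) (hA : A.Nonempty)
    (o x y b p₁ p₂ q₁ q₂ : Fin n) (ho : o ∉ A) (hx : x ∉ A) (hy : y ∉ A) (hxo : x ≠ o) (hyo : y ≠ o) (hxy : x ≠ y)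
    (hbo : b ≠ o) (hbx : b ≠ x) (hby : b ≠ y)
    (hp₁ : p₁ ∈ A) (hp₂ : p₂ ∈ A) (hq₁ : q₁ ∈ A) (hq₂ : q₂ ∈ A)
    (hp : p₁ ≠ p₂) (hq : q₁ ≠ q₂) (h11 : p₁ ≠ q₁) (h12 : p₁ ≠ q₂) (h21 : p₂ ≠ q₁) (h22 : p₂ ≠ q₂)
    (hoN : ∀ v : Fin n, v ≠ o → v ∉ A → v ≠ x → v ≠ y → w s(o, v) = 0)
    (hxN : ∀ z : Fin n, z ≠ p₁ → z ≠ p₂ → z ≠ o → w s(x, z) = 0)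
    (hyN : ∀ z : Fin n, z ≠ q₁ → z ≠ q₂ → z ≠ o → w s(y, z) = 0)
    (hh₁ : 0 < (w s(x, p₁) : ℝ)) (hh₁' : (w s(x, p₁) : ℝ) < 1) (hh₂ : 0 < (w s(x, p₂) : ℝ)) (hh₂' : (w s(x, p₂) : ℝ) < 1)
    (hk₁ : 0 < (w s(y, q₁) : ℝ)) (hk₁' : (w s(y, q₁) : ℝ) < 1) (hk₂ : 0 < (w s(y, q₂) : ℝ)) (hk₂' : (w s(y, q₂) : ℝ) < 1)
    (M : ℝ) (hM : ∀ a ∈ A, (prodBernoulli w).real (openConn a b : Set (BondConfig (Fin n)))ᶜ ≤ M) :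
    (prodBernoulli w).real (⋃ a ∈ A, (openConn o a : Set (BondConfig (Fin n)))) -
        (prodBernoulli w).real (openConn o b : Set (BondConfig (Fin n))) ≤
      (prodBernoulli w).real (⋃ a ∈ A, (openConn o a : Set (BondConfig (Fin n)))) * M :=
  conj1_weak_of_knGood w A hA o b
    (knGood_twoPendantTwoPortStars w A hA o x y b p₁ p₂ q₁ q₂ ho hx hy hxo hyo hxy hbo hbx hby hp₁ hp₂ hq₁ hq₂ hp hq h11 h12 h21 h22
      hoN hxN hyN hh₁ hh₁' hh₂ hh₂' hk₁ hk₁' hk₂ hk₂') M hM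

end KNGoodTwoTwo

end

end Summit.CriticalPhenomena.PercolationContinuityZ3.Theorems
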